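import Literature.Geometry.Lorentzian.AsymptoticFlatnessChart
import Literature.Geometry.Lorentzian.ScalarCurvatureLinearization
import Literature.Analysis.FluidPDE.ShellDivergence
import Literature.Analysis.FluidPDE.RadialTestIBP
import Literature.MeasureTheory.Hausdorff.SphereMeasure
import HarnessLib

/-!
# Bartnik's existence theorem for the ADM energy (discharge)

This file proves the named fact `AFEnd.HasADMEnergy_of_isAsymptoticallyFlat`
(`AsymptoticFlatness`): if the metric of an end is asymptotically flat of order `α > 1/2` and its
scalar curvature is integrable on the end, then the ADM energy fluxes
`E(r) = (16π)⁻¹ ∮_{S_r} ∑ᵢⱼ (∂ⱼhᵢⱼ − ∂ᵢhⱼⱼ) xⁱ/r dσ` converge as `r → ∞`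
(Bartnik, CPAM 39 (1986), §4, (4.2)–(4.4) and Thm. 4.2 (existence part); Arnowitt–Deser–Misner
1962). The argument, following Bartnik: with the ADM flux field `Vᵢ = ∑ⱼ (∂ⱼhᵢⱼ − ∂ᵢhⱼⱼ)`,

* `E(r) = c · r² ∮ ⟨x/‖x‖, V⟩` (the Hausdorff surface measure on round spheres is a multiple of the
  polar-coordinate measure: `Hausdorff.setIntegral_sphere_euclideanHausdorff`);
* `E(r₂) − E(r₁) = c ∫_{r₁<‖x‖<r₂} div V` (Gauss–Green on shells,
  `FluidPDE.setIntegral_shell_divergence_eq`, applied to a `C¹` cut-off extension of `V`);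
* `div V = R(h)∘Φ − Q` with `|Q| ≤ C (|h−δ| |∂²h| + |∂h|²) = O(r^{−2−2α})`
  (`AFEnd.scalarCurvatureCoeff_eq_coord`, `abs_scalarCoord_sub_linKoszul_le`, `linKoszul_eq_sum`,
  `trace_fderiv_admVec`), so `div V ∈ L¹({‖x‖ > R₂})` since `2 + 2α > 3` and `R(h)∘Φ ∈ L¹`;
* hence `E` is Cauchy at infinity and converges.

## References

* R. Bartnik, *The mass of an asymptotically flat manifold*, CPAM 39 (1986), §4, (4.2)–(4.4),
  Thm. 4.2.
* R. Arnowitt, S. Deser, C. W. Misner, *The dynamics of general relativity* (1962).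
* D. A. Lee, *Geometric Relativity* (2019), Ch. 3, §3.1.
-/

noncomputable section

-- instance search on the nested operator spaces of metric components and their derivatives
-- (`E3 →L[ℝ] E3 →L[ℝ] E3 →L[ℝ] E3 →L[ℝ] ℝ` for second derivatives) is deep and slow on `E3`
set_option maxSynthPendingDepth 3
set_option synthInstance.maxHeartbeats 200000

open Manifold Bundle TopologicalSpace Filter Metric MeasureTheory Asymptotics Bornology
open scoped ContDiff Topology RealInnerProductSpace

namespace Literature.Geometry.Lorentzian

namespace AFEnd

variable {X : Type*} [TopologicalSpace X] [ChartedSpace E3 X] [IsManifold (𝓡 3) ∞ X]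
  (e : AFEnd X) (D : InitialDataSet (𝓡 3) X)

/-! ### The flux as a polar-coordinate sphere integral of the ADM field -/

/-- **The ADM flux integrand is the normal component of the ADM field**: on the sphere
`‖x‖ = r`, `∑ᵢⱼ (∂ⱼhᵢⱼ − ∂ᵢhⱼⱼ)(x) xⁱ/r = ⟨x/‖x‖, V(x)⟩` for the field
`V = ∑ᵢ (∑ⱼ (∂ⱼhᵢⱼ − ∂ᵢhⱼⱼ)) eᵢ` (given through the representative hypothesis `hV`).
Bartnik 1986, (4.2). [cite: Bartnik1986, §4, (4.2)] -/
theorem flux_integrand_eq (V : E3 → E3)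
    (hV : ∀ x, V x = ∑ i, (∑ j, (partialH e D j i j x - partialH e D i j j x)) •
      EuclideanSpace.basisFun (Fin 3) ℝ i)
    {r : ℝ} {x : E3} (hx : ‖x‖ = r) :
    ∑ i : Fin 3, ∑ j : Fin 3, (partialH e D j i j x - partialH e D i j j x) * x i / r =
      ⟪‖x‖⁻¹ • x, V x⟫ := by
  rw [hV x, real_inner_smul_left, inner_sum, hx, Finset.mul_sum]
  refine Finset.sum_congr rfl fun i _ ↦ ?_
  rw [inner_smul_right, EuclideanSpace.basisFun_apply, EuclideanSpace.inner_single_right]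
  simp only [one_mul, conj_trivial]
  rw [Finset.sum_mul, Finset.mul_sum]
  refine Finset.sum_congr rfl fun j _ ↦ ?_
  ring

/-- **The ADM energy flux through round spheres as a polar-coordinate integral**: for `r > 0`,
`E(r) = (16π)⁻¹ κ r² ∮ ⟨x/‖x‖, V⟩|_{x = rα} dτ(α)` with `κ = μHE[2](S²)/τ(S²)` the (finite)
ratio between the Hausdorff surface measure and Mathlib's polar-coordinate measure `τ` on the
unit sphere (`Hausdorff.setIntegral_sphere_euclideanHausdorff`). Bartnik 1986, (4.2).
[cite: Bartnik1986, §4, (4.2)] -/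
theorem admEnergyFlux_eq_sphereIntegral (V : E3 → E3)
    (hV : ∀ x, V x = ∑ i, (∑ j, (partialH e D j i j x - partialH e D i j j x)) •
      EuclideanSpace.basisFun (Fin 3) ℝ i)
    {r : ℝ} (hr : 0 < r) :
    admEnergyFlux e D r = (16 * Real.pi)⁻¹ *
      ((((μHE[2] : Measure E3) (sphere (0 : E3) 1) / (volume : Measure E3).toSphere Set.univ).toReal
        * r ^ 2) * Analysis.FluidPDE.sphereIntegral (volume : Measure E3)
          (fun x ↦ ⟪‖x‖⁻¹ • x, V x⟫) r) := by
  unfold admEnergyFlux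
  congr 1
  have hd : Module.finrank ℝ E3 = 2 + 1 := by simp
  rw [setIntegral_congr_fun isClosed_sphere.measurableSet fun x hx ↦
    flux_integrand_eq e D V hV (mem_sphere_zero_iff_norm.1 hx),
    MeasureTheory.Hausdorff.setIntegral_sphere_euclideanHausdorff hd hr, smul_eq_mul]

/-! ### A `C¹` extension of the ADM field across the inner ball -/

/-- The ADM field in the form expected by `ScalarCurvatureLinearization` (components `hCoeff e D`
in the standard orthonormal frame). [folklore] -/
theorem admVec_repr (V : E3 → E3)
    (hV : ∀ x, V x = ∑ i, (∑ j, (partialH e D j i j x - partialH e D i j j x)) •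
      EuclideanSpace.basisFun (Fin 3) ℝ i) (y : E3) :
    V y = ∑ i, (∑ j, (fderiv ℝ (fun z ↦ hCoeff e D z (EuclideanSpace.basisFun (Fin 3) ℝ i)
      (EuclideanSpace.basisFun (Fin 3) ℝ j)) y (EuclideanSpace.basisFun (Fin 3) ℝ j) -
      fderiv ℝ (fun z ↦ hCoeff e D z (EuclideanSpace.basisFun (Fin 3) ℝ j)
        (EuclideanSpace.basisFun (Fin 3) ℝ j)) y (EuclideanSpace.basisFun (Fin 3) ℝ i))) •
      EuclideanSpace.basisFun (Fin 3) ℝ i := by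
  rw [hV y]
  simp only [partialH, EuclideanSpace.basisFun_apply]

/-- **A `C¹` extension of the ADM field.** There is a `C¹` vector field `W` on all of `ℝ³`
agreeing with `V` on `R + 2 ≤ ‖x‖` (`W = χ V` with the cut-off `χ`; `V` is `C¹` — indeed smooth —
on `{R < ‖x‖}` where the `h_ij` are smooth, `AFEnd.contDiffAt_hCoeff`). [folklore] -/
theorem exists_contDiff_extension (V : E3 → E3)
    (hV : ∀ x, V x = ∑ i, (∑ j, (partialH e D j i j x - partialH e D i j j x)) •
      EuclideanSpace.basisFun (Fin 3) ℝ i) :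
    ∃ W : E3 → E3, ContDiff ℝ 1 W ∧ ∀ x, e.R + 2 ≤ ‖x‖ → W x = V x := by
  obtain ⟨χ, hχ, hχ0, hχ1⟩ := exists_smooth_radial_cutoff e.R_pos.le
  refine ⟨fun x ↦ χ x • V x, contDiff_iff_contDiffAt.2 fun x ↦ ?_, fun x hx ↦ by
    simp only [hχ1 x hx, one_smul]⟩
  by_cases hx : e.R < ‖x‖
  · have hVx : ContDiffAt ℝ 1 V x :=
      contDiffAt_admVec (EuclideanSpace.basisFun (Fin 3) ℝ) (e.admVec_repr D V hV)
        (e.contDiffAt_hCoeff D hx)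
        (by rw [show (1 : ℕ∞ω) + 1 = 2 by norm_num]; exact WithTop.coe_le_coe.mpr le_top)
    exact (hχ.contDiffAt.of_le (WithTop.coe_le_coe.mpr le_top)).smul hVx
  · push Not at hx
    have hzero : (fun y ↦ χ y • V y) =ᶠ[𝓝 x] fun _ ↦ (0 : E3) := by
      have hball : ball (0 : E3) (e.R + 1) ∈ 𝓝 x :=
        isOpen_ball.mem_nhds (mem_ball_zero_iff.2 (by linarith))
      filter_upwards [hball] with y hy
      rw [hχ0 y (mem_ball_zero_iff.1 hy).le, zero_smul]
    exact contDiffAt_const.congr_of_eventuallyEq hzero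

/-! ### The divergence of the ADM field is the scalar curvature up to an integrable error -/

/-- **Pointwise linearisation estimate** (Bartnik 1986, (4.3)–(4.4)): for `R < ‖x‖` and
`‖h(x) − δ‖ ≤ 1/6`,
`|R(h)(Φ x) − div V(x)| ≤ 3⁴·3(6‖h−δ‖)(3‖∂²h‖) + 3⁶·4(3‖∂h‖)²` at `x`, where
`div V = tr DV = ∑ᵢₖ (∂ᵢ∂ₖhᵢₖ − ∂ᵢ∂ᵢhₖₖ)` (`trace_fderiv_admVec`, `linKoszul_eq_sum`,
`abs_scalarCoord_sub_linKoszul_le`, `scalarCurvatureCoeff_eq_coord`).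
[cite: Bartnik1986, §4, (4.3)–(4.4)] -/
theorem abs_scalarCurvatureCoeff_sub_trace_le [D.metric.HasLeviCivita] (V : E3 → E3)
    (hV : ∀ x, V x = ∑ i, (∑ j, (partialH e D j i j x - partialH e D i j j x)) •
      EuclideanSpace.basisFun (Fin 3) ℝ i)
    {x : E3} (hx : e.R < ‖x‖)
    (hε : ‖hCoeff e D x - (innerSL ℝ : E3 →L[ℝ] E3 →L[ℝ] ℝ)‖ ≤ 1 / 6) :
    |scalarCurvatureCoeff e D x - LinearMap.trace ℝ E3 (fderiv ℝ V x : E3 →ₗ[ℝ] E3)| ≤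
      (3 : ℝ) ^ 4 * (3 * (2 * 3 * ‖hCoeff e D x - (innerSL ℝ : E3 →L[ℝ] E3 →L[ℝ] ℝ)‖) *
          (3 * ‖fderiv ℝ (fderiv ℝ (hCoeff e D)) x‖))
        + (3 : ℝ) ^ 6 * (4 * (3 * ‖fderiv ℝ (hCoeff e D) x‖) ^ 2) := by
  set b := EuclideanSpace.basisFun (Fin 3) ℝ with hb
  have hG2 : ContDiffAt ℝ 2 (hCoeff e D) x :=
    (e.contDiffAt_hCoeff D hx).of_le (WithTop.coe_le_coe.mpr le_top)
  rw [trace_fderiv_admVec b (e.admVec_repr D V hV) hG2, ← linKoszul_eq_sum b hG2 (hCoeff_symm e D),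
    e.scalarCurvatureCoeff_eq_coord D b hx]
  have h3 : (Fintype.card (Fin 3) : ℝ) = 3 := by simp
  have hε' : ‖hCoeff e D x - (innerSL ℝ : E3 →L[ℝ] E3 →L[ℝ] ℝ)‖ ≤
      1 / (2 * Fintype.card (Fin 3)) := by
    rw [h3]; norm_num at hε ⊢; exact hε
  have := abs_scalarCoord_sub_linKoszul_le b hG2 hε'
  rw [h3] at this
  exact this

/-- **The error is `O(‖x‖^{-2-2α})`.** Under asymptotic flatness of order `α > 0` there are
`K` and `R₁` (with `R + 2 < R₁`, `1 ≤ R₁`) such that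
`|R(h)(Φ x) − div V(x)| ≤ K ‖x‖^{−(2α+2)}` for `R₁ ≤ ‖x‖` (the three decay hypotheses
`|h−δ| ≤ c₀ r^{−α}`, `|∂h| ≤ c₁ r^{−α−1}`, `|∂²h| ≤ c₂ r^{−α−2}` inserted in the pointwise
estimate). Bartnik 1986, (4.4). [cite: Bartnik1986, §4, (4.4)] -/
theorem exists_bound_scalarCurvatureCoeff_sub_trace [D.metric.HasLeviCivita] (V : E3 → E3)
    (hV : ∀ x, V x = ∑ i, (∑ j, (partialH e D j i j x - partialH e D i j j x)) •
      EuclideanSpace.basisFun (Fin 3) ℝ i)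
    {α : ℝ} (hα : 0 < α) (hAF : IsMetricAsymptoticallyFlat e D α) :
    ∃ K R₁ : ℝ, e.R + 2 < R₁ ∧ 1 ≤ R₁ ∧ ∀ x : E3, R₁ ≤ ‖x‖ →
      |scalarCurvatureCoeff e D x - LinearMap.trace ℝ E3 (fderiv ℝ V x : E3 →ₗ[ℝ] E3)| ≤
        K * ‖x‖ ^ (-(2 * α + 2)) := by
  -- the three decay hypotheses, with positive constants
  obtain ⟨c₀, hc₀, h0⟩ := (hAF 0 (by norm_num)).exists_pos
  obtain ⟨c₁, hc₁, h1⟩ := (hAF 1 (by norm_num)).exists_pos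
  obtain ⟨c₂, hc₂, h2⟩ := (hAF 2 (by norm_num)).exists_pos
  have hfd : ∀ y, fderiv ℝ (fun y ↦ hCoeff e D y - (innerSL ℝ : E3 →L[ℝ] E3 →L[ℝ] ℝ)) y =
      fderiv ℝ (hCoeff e D) y := fun y ↦ fderiv_sub_const _
  have hfdd : fderiv ℝ (fderiv ℝ (fun y ↦ hCoeff e D y - (innerSL ℝ : E3 →L[ℝ] E3 →L[ℝ] ℝ))) =
      fderiv ℝ (fderiv ℝ (hCoeff e D)) := by
    have : fderiv ℝ (fun y ↦ hCoeff e D y - (innerSL ℝ : E3 →L[ℝ] E3 →L[ℝ] ℝ)) =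
        fderiv ℝ (hCoeff e D) := funext hfd
    rw [this]
  -- smallness of `‖h - δ‖`
  have hsmall : ∀ᶠ x in cobounded E3, c₀ * ‖x‖ ^ (-α) < 1 / 6 := by
    have ht : Tendsto (fun x : E3 ↦ c₀ * ‖x‖ ^ (-α)) (cobounded E3) (𝓝 0) := by
      rw [← mul_zero c₀]
      exact ((tendsto_rpow_neg_atTop hα).comp tendsto_norm_cobounded_atTop).const_mul c₀
    exact ht.eventually (Iio_mem_nhds (by norm_num))
  set K : ℝ := (3 : ℝ) ^ 4 * (3 * (2 * 3 * c₀) * (3 * c₂)) + (3 : ℝ) ^ 6 * (4 * (3 * c₁) ^ 2)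
    with hK
  have hev : ∀ᶠ x in cobounded E3,
      |scalarCurvatureCoeff e D x - LinearMap.trace ℝ E3 (fderiv ℝ V x : E3 →ₗ[ℝ] E3)| ≤
        K * ‖x‖ ^ (-(2 * α + 2)) := by
    filter_upwards [h0.bound, h1.bound, h2.bound, hsmall, eventually_cobounded_le_norm (E := E3)
      (e.R + 1), eventually_cobounded_le_norm (E := E3) 1] with x hx0 hx1 hx2 hxs hxR hx1'
    have hxpos : 0 < ‖x‖ := by linarith
    have hRx : e.R < ‖x‖ := by linarith
    -- rewrite the decay bounds
    rw [norm_norm, norm_iteratedFDeriv_zero, Real.norm_of_nonneg (Real.rpow_nonneg hxpos.le _)]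
      at hx0
    rw [norm_norm, norm_iteratedFDeriv_one, hfd,
      Real.norm_of_nonneg (Real.rpow_nonneg hxpos.le _)] at hx1
    rw [norm_norm, ← norm_iteratedFDeriv_fderiv, norm_iteratedFDeriv_one, hfdd,
      Real.norm_of_nonneg (Real.rpow_nonneg hxpos.le _)] at hx2
    have hε0 : ‖hCoeff e D x - (innerSL ℝ : E3 →L[ℝ] E3 →L[ℝ] ℝ)‖ ≤ c₀ * ‖x‖ ^ (-α) := by
      simpa using hx0
    have hε : ‖hCoeff e D x - (innerSL ℝ : E3 →L[ℝ] E3 →L[ℝ] ℝ)‖ ≤ 1 / 6 := hε0.trans hxs.le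
    have hmain := e.abs_scalarCurvatureCoeff_sub_trace_le D V hV hRx hε
    -- compare the bound with `K ‖x‖^{-(2α+2)}`
    set ε := ‖hCoeff e D x - (innerSL ℝ : E3 →L[ℝ] E3 →L[ℝ] ℝ)‖ with hεdef
    set p := ‖fderiv ℝ (fderiv ℝ (hCoeff e D)) x‖ with hpdef
    set q := ‖fderiv ℝ (hCoeff e D) x‖ with hqdef
    have hq1 : q ≤ c₁ * ‖x‖ ^ (-α - 1) := by simpa using hx1
    have hp2 : p ≤ c₂ * ‖x‖ ^ (-α - 2) := by
      have : ((2 : ℕ) : ℝ) = 2 := by norm_num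
      rw [this] at hx2
      exact hx2
    have hpnn : 0 ≤ p := norm_nonneg (fderiv ℝ (fderiv ℝ (hCoeff e D)) x)
    have hqnn : 0 ≤ q := norm_nonneg (fderiv ℝ (hCoeff e D) x)
    have hr1 : ‖x‖ ^ (-α) * ‖x‖ ^ (-α - 2) = ‖x‖ ^ (-(2 * α + 2)) := by
      rw [← Real.rpow_add hxpos]
      congr 1
      ring
    have hr2 : (‖x‖ ^ (-α - 1)) ^ 2 = ‖x‖ ^ (-(2 * α + 2)) := by
      rw [← Real.rpow_natCast, ← Real.rpow_mul hxpos.le]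
      congr 1
      push_cast
      ring
    have hεp : ε * p ≤ (c₀ * ‖x‖ ^ (-α)) * (c₂ * ‖x‖ ^ (-α - 2)) :=
      mul_le_mul hε0 hp2 hpnn (by positivity)
    have hq2 : q ^ 2 ≤ (c₁ * ‖x‖ ^ (-α - 1)) ^ 2 := pow_le_pow_left₀ hqnn hq1 2
    have hrpos : 0 ≤ ‖x‖ ^ (-(2 * α + 2)) := Real.rpow_nonneg hxpos.le _
    calc |scalarCurvatureCoeff e D x - LinearMap.trace ℝ E3 (fderiv ℝ V x : E3 →ₗ[ℝ] E3)|
        ≤ (3 : ℝ) ^ 4 * (3 * (2 * 3 * ε) * (3 * p)) + (3 : ℝ) ^ 6 * (4 * (3 * q) ^ 2) := hmain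
      _ = (3 : ℝ) ^ 4 * 54 * (ε * p) + (3 : ℝ) ^ 6 * 36 * q ^ 2 := by ring
      _ ≤ (3 : ℝ) ^ 4 * 54 * ((c₀ * ‖x‖ ^ (-α)) * (c₂ * ‖x‖ ^ (-α - 2))) +
          (3 : ℝ) ^ 6 * 36 * (c₁ * ‖x‖ ^ (-α - 1)) ^ 2 := by gcongr
      _ = K * ‖x‖ ^ (-(2 * α + 2)) := by
          rw [hK, mul_pow, hr2, show (c₀ * ‖x‖ ^ (-α)) * (c₂ * ‖x‖ ^ (-α - 2)) =
            c₀ * c₂ * (‖x‖ ^ (-α) * ‖x‖ ^ (-α - 2)) by ring, hr1]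
          ring
  obtain ⟨R₁, hR₁⟩ := exists_radius_of_eventually hev
  refine ⟨K, max R₁ (max (e.R + 3) 1), by
    have := le_max_left (e.R + 3) 1; have := le_max_right R₁ (max (e.R + 3) 1); linarith,
    (le_max_right _ _).trans (le_max_right _ _), fun x hx ↦ hR₁ x ((le_max_left _ _).trans hx)⟩

/-! ### Bartnik's theorem -/

/-- **DISCHARGE of `HasADMEnergy_of_isAsymptoticallyFlat` (Bartnik's existence theorem for the
ADM energy, CPAM 39 (1986), §4, (4.2)–(4.4), existence part of Thm. 4.2).** If `h − δ = O₂(r^{−α})`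
with `α > 1/2` and the scalar curvature is integrable on the end, then the ADM energy fluxes
converge. Proof (Bartnik): Gauss–Green on coordinate shells turns `E(r₂) − E(r₁)` into the
integral of `div V = R(h)∘Φ − Q` over `{r₁ < ‖x‖ < r₂}`, where `Q = O(r^{−2−2α}) ∈ L¹` by the
decay and `R(h)∘Φ ∈ L¹` by hypothesis; so `E` is Cauchy at infinity. The standing instance
`[D.metric.HasLeviCivita]` of the fact is supplied outright by `PseudoRiemannianMetric.hasLeviCivita`
(a `Prop`, so this is the fact for every instance). [cite: Bartnik1986, §4, (4.2)–(4.4) and Thm. 4.2] -/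
theorem HasADMEnergy_of_isAsymptoticallyFlat_holds :
    haveI := D.metric.hasLeviCivita
    HasADMEnergy_of_isAsymptoticallyFlat e D := by
  haveI := D.metric.hasLeviCivita
  intro α hα hAF R' hR' hint
  classical
  -- the ADM field and its `C¹` extension
  set V : E3 → E3 := fun x ↦ ∑ i, (∑ j, (partialH e D j i j x - partialH e D i j j x)) •
    EuclideanSpace.basisFun (Fin 3) ℝ i with hVdef
  have hV : ∀ x, V x = ∑ i, (∑ j, (partialH e D j i j x - partialH e D i j j x)) •
      EuclideanSpace.basisFun (Fin 3) ℝ i := fun x ↦ rfl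
  obtain ⟨W, hW, hWV⟩ := e.exists_contDiff_extension D V hV
  obtain ⟨K, R₁, hR₁, hR₁', hbound⟩ :=
    e.exists_bound_scalarCurvatureCoeff_sub_trace D V hV (by linarith) hAF
  -- the divergence of `W`
  set L : E3 → ℝ := fun x ↦ LinearMap.trace ℝ E3 (fderiv ℝ W x : E3 →ₗ[ℝ] E3) with hL
  have hLc : Continuous L := Analysis.FluidPDE.continuous_trace_fderiv hW
  have hLV : ∀ x, e.R + 2 < ‖x‖ → L x = LinearMap.trace ℝ E3 (fderiv ℝ V x : E3 →ₗ[ℝ] E3) := by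
    intro x hx
    have heq : W =ᶠ[𝓝 x] V := by
      have hopen : IsOpen {y : E3 | e.R + 2 < ‖y‖} := isOpen_lt continuous_const continuous_norm
      filter_upwards [hopen.mem_nhds hx] with y hy
      exact hWV y (le_of_lt hy)
    simp only [hL, heq.fderiv_eq]
  -- integrability of `L` on `{R₂ < ‖x‖}`
  set R₂ : ℝ := max R' R₁ with hR₂
  have hR₂R : e.R + 2 < R₂ := lt_of_lt_of_le hR₁ (le_max_right _ _)
  have hR₂pos : 0 < R₂ := by have := e.R_pos; linarith
  have hmeas : ∀ a : ℝ, MeasurableSet {x : E3 | a < ‖x‖} := fun a ↦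
    (isOpen_lt continuous_const continuous_norm).measurableSet
  have hLint : IntegrableOn L {x | R₂ < ‖x‖} volume := by
    have hS : IntegrableOn (scalarCurvatureCoeff e D) {x | R₂ < ‖x‖} volume :=
      hint.mono_set fun x (hx : R₂ < ‖x‖) ↦ show R' < ‖x‖ from lt_of_le_of_lt (le_max_left _ _) hx
    have hE : IntegrableOn (fun x ↦ scalarCurvatureCoeff e D x - L x) {x | R₂ < ‖x‖} volume := by
      have hg : IntegrableOn (fun x : E3 ↦ K * ‖x‖ ^ (-(2 * α + 2))) {x | R₂ < ‖x‖} volume :=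
        (integrableOn_rpow_neg_exterior (by linarith) (hR₁'.trans (le_max_right _ _))).const_mul K
      refine Integrable.mono' hg (hS.aestronglyMeasurable.sub hLc.aestronglyMeasurable) ?_
      refine (ae_restrict_iff' (hmeas R₂)).2 (ae_of_all _ fun x hx ↦ ?_)
      have hx1 : R₁ ≤ ‖x‖ := (le_max_right _ _).trans (le_of_lt hx)
      rw [Real.norm_eq_abs, hLV x (by linarith)]
      exact hbound x hx1
    have := hS.sub hE
    refine this.congr_fun (fun x _ ↦ ?_) (hmeas R₂)
    simp
  -- tails of `∫ |L|` tend to zero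
  have hLabs : IntegrableOn (fun x ↦ |L x|) {x | R₂ < ‖x‖} volume := hLint.abs
  have htail : Tendsto (fun n : ℕ ↦ ∫ x in {x : E3 | max R₂ n < ‖x‖}, |L x|) atTop (𝓝 0) := by
    have hanti : Antitone fun n : ℕ ↦ {x : E3 | max R₂ n < ‖x‖} := by
      intro m n hmn x hx
      simp only [Set.mem_setOf_eq] at hx ⊢
      calc max R₂ (m : ℝ) ≤ max R₂ (n : ℝ) := max_le_max le_rfl (by exact_mod_cast hmn)
        _ < ‖x‖ := hx
    have h := tendsto_setIntegral_of_antitone (μ := (volume : Measure E3)) (f := fun x ↦ |L x|)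
      (s := fun n : ℕ ↦ {x : E3 | max R₂ n < ‖x‖}) (fun n ↦ hmeas _) hanti
      ⟨0, hLabs.mono_set fun x (hx : max R₂ ((0 : ℕ) : ℝ) < ‖x‖) ↦
        show R₂ < ‖x‖ from lt_of_le_of_lt (le_max_left _ _) hx⟩
    have hempty : (⋂ n : ℕ, {x : E3 | max R₂ n < ‖x‖}) = ∅ := by
      ext x
      simp only [Set.mem_iInter, Set.mem_setOf_eq, Set.mem_empty_iff_false, iff_false, not_forall,
        not_lt]
      obtain ⟨n, hn⟩ := exists_nat_ge ‖x‖
      exact ⟨n, hn.trans (le_max_right _ _)⟩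
    rwa [hempty, Measure.restrict_empty, integral_zero_measure] at h
  -- the flux function and Gauss–Green on shells
  set A : ℝ → ℝ := fun r ↦ r ^ (Module.finrank ℝ E3 - 1) *
    Analysis.FluidPDE.sphereIntegral (volume : Measure E3) (fun x ↦ ⟪‖x‖⁻¹ • x, W x⟫) r with hA
  have hAdiff : ∀ a c : ℝ, R₂ ≤ a → a ≤ c →
      A c - A a = ∫ x in {x : E3 | a < ‖x‖ ∧ ‖x‖ < c}, L x := by
    intro a c ha hac
    have := Analysis.FluidPDE.setIntegral_shell_divergence_eq (volume : Measure E3) hW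
      (by linarith) hac
    simp only [hA, hL]
    linarith
  have hAbound : ∀ a c : ℝ, R₂ ≤ a → a ≤ c → |A c - A a| ≤ ∫ x in {x : E3 | a < ‖x‖}, |L x| := by
    intro a c ha hac
    rw [hAdiff a c ha hac]
    have hsub : {x : E3 | a < ‖x‖ ∧ ‖x‖ < c} ⊆ {x : E3 | a < ‖x‖} := fun x hx ↦ hx.1
    have hIa : IntegrableOn (fun x ↦ |L x|) {x : E3 | a < ‖x‖} volume :=
      hLabs.mono_set fun x (hx : a < ‖x‖) ↦ show R₂ < ‖x‖ from lt_of_le_of_lt ha hx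
    calc |∫ x in {x : E3 | a < ‖x‖ ∧ ‖x‖ < c}, L x|
        ≤ ∫ x in {x : E3 | a < ‖x‖ ∧ ‖x‖ < c}, |L x| := abs_integral_le_integral_abs
      _ ≤ ∫ x in {x : E3 | a < ‖x‖}, |L x| :=
          setIntegral_mono_set hIa (ae_of_all _ fun x ↦ abs_nonneg _)
            (ae_of_all _ hsub)
  have hCauchy : CauchySeq A := by
    refine Metric.cauchySeq_iff'.2 fun ε hε ↦ ?_
    have := (tendsto_order.1 htail).2 ε hε
    obtain ⟨N, hN⟩ := eventually_atTop.1 this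
    refine ⟨max R₂ (N : ℝ), fun r hr ↦ ?_⟩
    rw [Real.dist_eq]
    calc |A r - A (max R₂ (N : ℝ))| ≤ ∫ x in {x : E3 | max R₂ (N : ℝ) < ‖x‖}, |L x| :=
          hAbound _ _ (le_max_left _ _) hr
      _ < ε := hN N le_rfl
  obtain ⟨ℓ, hℓ⟩ := cauchySeq_tendsto_of_complete hCauchy
  -- the flux is a constant multiple of `A` for large radii
  set κ : ℝ := (16 * Real.pi)⁻¹ *
    (((μHE[2] : Measure E3) (sphere (0 : E3) 1) / (volume : Measure E3).toSphere Set.univ).toReal)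
    with hκ
  have hflux : ∀ᶠ r in atTop, κ * A r = admEnergyFlux e D r := by
    filter_upwards [eventually_ge_atTop (e.R + 2), eventually_gt_atTop (0 : ℝ)] with r hr hr0
    rw [e.admEnergyFlux_eq_sphereIntegral D V hV hr0]
    simp only [hA, hκ]
    have hd : Module.finrank ℝ E3 - 1 = 2 := by simp
    have hsph : Analysis.FluidPDE.sphereIntegral (volume : Measure E3) (fun x ↦ ⟪‖x‖⁻¹ • x, W x⟫) r
        = Analysis.FluidPDE.sphereIntegral (volume : Measure E3) (fun x ↦ ⟪‖x‖⁻¹ • x, V x⟫) r := by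
      simp only [Analysis.FluidPDE.sphereIntegral_def]
      refine integral_congr_ae (ae_of_all _ fun θ ↦ ?_)
      dsimp only
      rw [hWV _ (by rw [Analysis.FluidPDE.norm_smul_sphere hr0.le θ]; exact hr)]
    rw [hd, hsph]
    try ring
  exact ⟨κ * ℓ, (hℓ.const_mul κ).congr' hflux⟩

end AFEnd

end Literature.Geometry.Lorentzian

end
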